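import Summits.QuantumAdvantage.QuantumAdvantage.Theorems.CharDialSchedCounterSubcubeA
import Summits.QuantumAdvantage.QuantumAdvantage.Theorems.CharDialCounterSubcube

/-! # CharDialSchedCounterSubcube — part 2/2 (mechanical split for landing of `CharDialSchedCounterSubcube`; content verbatim; scopes re-opened with their variables) -/


namespace Summit.QuantumAdvantage.AdviceFreeQNC0
open Finset AffBells22

namespace CounterLaw

section SubProcess
variable {n : ℕ} (p : ℕ) (y : Fin (n + 1) → (Fin n → Bool) → Bool) (τ : Fin n → Bool × Bool)
  (W : Finset (Fin n)) (b : Fin n → Bool)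

/-- **scheduled free bit step**: at `t ∉ W` the law is the average of the two bijected copies. -/
theorem lawT_succ_free (t : Fin n) (ht : t ∉ W) (x : St p) :
    lawT p y τ W b (t.val + 1) x
      = (lawTp p y τ W b t.val ((bitEq p false).symm x)
          + lawTp p y τ W b t.val ((bitEq p true).symm ((togSt p (τ t)).symm x))) / 2 := by
  have hm : ∀ u : Fin n → Bool, subcubeMerge W b u t = u t := fun u => merge_apply_free W b u ht
  have hsplit : (univ.filter fun u : Fin n → Bool => XT p y τ (subcubeMerge W b u) (t.val + 1) = x)
      = (univ.filter fun u : Fin n → Bool =>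
            u t = false ∧ XTp p y τ (subcubeMerge W b u) t.val = (bitEq p false).symm x) ∪
        (univ.filter fun u : Fin n → Bool =>
            u t = true ∧ XTp p y τ (subcubeMerge W b u) t.val = (bitEq p true).symm ((togSt p (τ t)).symm x)) := by
    ext u
    simp only [mem_filter, mem_univ, true_and, mem_union, XT_succ, Equiv.eq_symm_apply, hm]
    cases u t
    · simp [togSt_apply]
    · simp
  have hdisj : Disjoint
      (univ.filter fun u : Fin n → Bool =>
        u t = false ∧ XTp p y τ (subcubeMerge W b u) t.val = (bitEq p false).symm x)
      (univ.filter fun u : Fin n → Bool =>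
        u t = true ∧ XTp p y τ (subcubeMerge W b u) t.val = (bitEq p true).symm ((togSt p (τ t)).symm x)) := by
    rw [disjoint_filter]
    rintro u _ ⟨h1, _⟩ ⟨h2, _⟩
    rw [h1] at h2; exact Bool.false_ne_true h2
  unfold lawT
  rw [hsplit, card_union_of_disjoint hdisj, Nat.cast_add,
    card_filter_bit_eq_half t false _
      (fun u b' => by rw [merge_update_free W b u ht, XTp_update p y τ _ t b' le_rfl]),
    card_filter_bit_eq_half t true _
      (fun u b' => by rw [merge_update_free W b u ht, XTp_update p y τ _ t b' le_rfl])]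
  unfold lawTp
  ring

/-- the scheduled free step, unfolded. -/
theorem lawT_succ_free' (t : Fin n) (ht : t ∉ W) (x : St p) :
    lawT p y τ W b (t.val + 1) x
      = (lawTp p y τ W b t.val (x.1, x.2.1 - 1, x.2.2) + lawTp p y τ W b t.val (bx x.1 (τ t), x.2.1 - 2, x.2.2 - 1)) / 2 := by
  rw [lawT_succ_free p y τ W b t ht, togSt_symm_apply, bitEq_symm_apply, bitEq_symm_apply]
  simp only [Bool.toNat_false, Bool.toNat_true, add_zero, Nat.cast_one, Nat.cast_zero, sub_zero, Nat.reduceAdd,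
    Nat.cast_ofNat]

/-- **frozen bit step**: at `t ∈ W` the law moves by the bijection `togSt (sched) ∘ bitEq (b t)`. -/
theorem lawT_succ_frozen (t : Fin n) (ht : t ∈ W) (x : St p) :
    lawT p y τ W b (t.val + 1) x
      = lawTp p y τ W b t.val ((bitEq p (b t)).symm ((togSt p (if b t then τ t else (false, false))).symm x)) := by
  have hm : ∀ u : Fin n → Bool, subcubeMerge W b u t = b t := fun u => merge_apply_frozen W b u ht
  unfold lawT lawTp
  congr 2
  ext u
  simp only [mem_filter, mem_univ, true_and, XT_succ, Equiv.eq_symm_apply, hm]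

/-- the initial law is the point mass `2ⁿ·δ_{(0,0,0)}`. -/
theorem lawT_zero (x : St p) : lawT p y τ W b 0 x = if x = ((false, false), 0, 0) then 2 ^ n else 0 := by
  unfold lawT
  simp only [XT_zero]
  by_cases hx : x = ((false, false), 0, 0)
  · rw [if_pos hx]; subst hx; simp
  · rw [if_neg hx]
    simp [Ne.symm hx]

variable [NeZero p]

/-- CharDialSchedCounterSubcube helper `sum_lawT` (decomp-qadv land package; see the module docstring). -/
theorem sum_lawT (t : ℕ) : ∑ x, lawT p y τ W b t x = 2 ^ n := by
  unfold lawT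
  rw [← Nat.cast_sum, ← card_eq_sum_card_fiberwise (s := univ) (t := univ)
    (fun u _ => mem_univ (XT p y τ (subcubeMerge W b u) t))]
  simp

/-- CharDialSchedCounterSubcube helper `sum_lawTp` (decomp-qadv land package; see the module docstring). -/
theorem sum_lawTp (t : ℕ) : ∑ x, lawTp p y τ W b t x = 2 ^ n := by
  unfold lawTp
  rw [← Nat.cast_sum, ← card_eq_sum_card_fiberwise (s := univ) (t := univ)
    (fun u _ => mem_univ (XTp p y τ (subcubeMerge W b u) t))]
  simp

/-- the count of merged inputs whose final `(register, label)` lies in the member `L_{i₀}`, as a mass of the final law. -/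
theorem card_memT_eq (i₀ : Idx) :
    ((univ.filter fun u : Fin n → Bool =>
        mem i₀ (XTp p y τ (subcubeMerge W b u) n).1 (XTp p y τ (subcubeMerge W b u) n).2.1 = true).card : ℝ)
      = ∑ b' : ZMod p, mass (lawTp p y τ W b n) i₀ b' := by
  rw [card_eq_sum_card_fiberwise (t := univ) (f := fun u => XTp p y τ (subcubeMerge W b u) n) (fun u _ => mem_univ _),
    Nat.cast_sum, sum_St]
  refine sum_congr rfl fun b' _ => ?_
  unfold mass lawTp
  refine sum_congr rfl fun g _ => sum_congr rfl fun a _ => ?_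
  by_cases hmm : mem i₀ g a = true
  · rw [if_pos hmm]
    congr 2; ext u
    simp only [mem_filter, mem_univ, true_and]
    constructor
    · exact fun h => h.2
    · intro h; refine ⟨?_, h⟩; rw [h]; exact hmm
  · rw [if_neg hmm]
    norm_cast
    rw [card_eq_zero, filter_eq_empty_iff]
    rintro u hu h
    simp only [mem_filter, mem_univ, true_and] at hu
    rw [h] at hu; exact hmm hu

end SubProcess

/-! ## §4 The `L²` budget over the free steps -/

section Budget

variable {n : ℕ} (p : ℕ) [NeZero p] (y : Fin (n + 1) → (Fin n → Bool) → Bool) (τ : Fin n → Bool × Bool)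
  (W : Finset (Fin n)) (b : Fin n → Bool)

omit [NeZero p] in
/-- `bit₁⁻¹ ∘ tog⁻¹ ∘ bit₀ = RT⁻¹`: the two branches of the scheduled free step differ by `RT (τ t)`. -/
theorem bitEqT_symm_bitEq_false (s : Bool × Bool) (x : St p) :
    (bitEq p true).symm ((togSt p s).symm (bitEq p false x)) = (RT p s).symm x := by
  rcases x with ⟨g, a, b'⟩
  rw [RT_symm_apply, bitEq_apply, togSt_symm_apply, bitEq_symm_apply]
  simp only [Bool.toNat_false, Bool.toNat_true, add_zero, Nat.cast_one, Nat.cast_zero, Prod.mk.injEq, true_and]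
  constructor
  · ring
  · simp

/-- fires preserve `Q`. -/
theorem Q_lawTp (t : ℕ) : Q (lawTp p y τ W b t) = Q (lawT p y τ W b t) := by
  have h : lawTp p y τ W b t = fun x =>
      lawT p y τ W b t (Function.Involutive.toPerm (fireMap p y t) (fireMap_fireMap p y t) x) := by
    funext x; exact lawTp_eq p y τ W b t x
  rw [h]; exact Q_comp_equiv _ _

/-- **parallelogram at a scheduled free step**: the decrement is the defect w.r.t. `RT (τ t)`. -/
theorem Q_lawT_succ_free (t : Fin n) (ht : t ∉ W) :
    Q (lawT p y τ W b (t.val + 1)) = Q (lawTp p y τ W b t.val) - D2T p (τ t) (lawTp p y τ W b t.val) / 4 := by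
  have h : lawT p y τ W b (t.val + 1) = fun x =>
      (lawTp p y τ W b t.val ((bitEq p false).symm x)
        + lawTp p y τ W b t.val (((bitEq p true).trans (togSt p (τ t))).symm x)) / 2 := by
    funext x; rw [lawT_succ_free p y τ W b t ht x]; rfl
  rw [h, Q_avg, Q_comp_equiv, Q_comp_equiv]
  have hD : ∑ x, (lawTp p y τ W b t.val ((bitEq p false).symm x)
      - lawTp p y τ W b t.val (((bitEq p true).trans (togSt p (τ t))).symm x)) ^ 2
      = D2T p (τ t) (lawTp p y τ W b t.val) := by
    unfold D2T
    rw [← Equiv.sum_comp (bitEq p false)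
      (fun x => (lawTp p y τ W b t.val ((bitEq p false).symm x)
        - lawTp p y τ W b t.val (((bitEq p true).trans (togSt p (τ t))).symm x)) ^ 2)]
    refine sum_congr rfl fun x _ => ?_
    simp only [Equiv.symm_apply_apply]
    rw [Equiv.symm_trans_apply, bitEqT_symm_bitEq_false]
  rw [hD]; ring

/-- a frozen step preserves `Q`. -/
theorem Q_lawT_succ_frozen (t : Fin n) (ht : t ∈ W) : Q (lawT p y τ W b (t.val + 1)) = Q (lawTp p y τ W b t.val) := by
  have h : lawT p y τ W b (t.val + 1) = fun x =>
      lawTp p y τ W b t.val ((bitEq p (b t)).symm ((togSt p (if b t then τ t else (false, false))).symm x)) := by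
    funext x; exact lawT_succ_frozen p y τ W b t ht x
  have e : (fun x => lawTp p y τ W b t.val ((bitEq p (b t)).symm ((togSt p (if b t then τ t else (false, false))).symm x)))
      = fun x => lawTp p y τ W b t.val
          (((togSt p (if b t then τ t else (false, false))).trans (bitEq p (b t))).symm x) := by
    funext x; rfl
  rw [h, e]; exact Q_comp_equiv _ _

/-- `Q` does not increase along the process. -/
theorem Q_lawT_succ_le (t : Fin n) : Q (lawT p y τ W b (t.val + 1)) ≤ Q (lawT p y τ W b t.val) := by
  rw [← Q_lawTp p y τ W b t.val]
  by_cases ht : t ∈ W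
  · rw [Q_lawT_succ_frozen p y τ W b t ht]
  · rw [Q_lawT_succ_free p y τ W b t ht]
    linarith [D2T_nonneg p (τ t) (lawTp p y τ W b t.val)]

/-- `Q(lawT 0) = (2ⁿ)²`. -/
theorem Q_lawT_zero : Q (lawT p y τ W b 0) = ((2 : ℝ) ^ n) ^ 2 := by
  unfold Q
  simp only [lawT_zero]
  rw [Finset.sum_eq_single ((false, false), (0 : ZMod 3), (0 : ZMod p))]
  · simp
  · intro x _ hx; rw [if_neg hx]; ring
  · intro h; exact absurd (mem_univ _) h

/-- Cauchy–Schwarz: `(2ⁿ)² ≤ 12p·Q(lawT t)`. -/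
theorem sq_le_Q_lawT (t : ℕ) : ((2 : ℝ) ^ n) ^ 2 ≤ 12 * p * Q (lawT p y τ W b t) := by
  have h := sq_sum_le_card_mul_Q (lawT p y τ W b t)
  rw [sum_lawT, card_St] at h
  push_cast at h; exact h

/-- **the budget over the FREE steps**: `Σ_{t ∉ W} D2T(τ t)(lawTp t) ≤ 4·(2ⁿ)²·(1 − 1/12p)`. -/
theorem sum_D2T_free_le :
    ∑ t ∈ (univ : Finset (Fin n)).filter (fun t => t ∉ W), D2T p (τ t) (lawTp p y τ W b t.val)
      ≤ 4 * ((2 : ℝ) ^ n) ^ 2 * (1 - 1 / (12 * p)) := by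
  have hfree : ∑ t ∈ (univ : Finset (Fin n)).filter (fun t => t ∉ W), D2T p (τ t) (lawTp p y τ W b t.val)
      = ∑ t ∈ (univ : Finset (Fin n)).filter (fun t => t ∉ W),
          4 * (Q (lawT p y τ W b t.val) - Q (lawT p y τ W b (t.val + 1))) := by
    refine sum_congr rfl fun t ht => ?_
    rw [mem_filter] at ht
    rw [Q_lawT_succ_free p y τ W b t ht.2, Q_lawTp]; ring
  have hmono : ∑ t ∈ (univ : Finset (Fin n)).filter (fun t => t ∉ W),
        4 * (Q (lawT p y τ W b t.val) - Q (lawT p y τ W b (t.val + 1)))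
      ≤ ∑ t : Fin n, 4 * (Q (lawT p y τ W b t.val) - Q (lawT p y τ W b (t.val + 1))) :=
    sum_le_sum_of_subset_of_nonneg (filter_subset _ _)
      (fun t _ _ => by linarith [Q_lawT_succ_le p y τ W b t])
  have htel : ∑ t : Fin n, 4 * (Q (lawT p y τ W b t.val) - Q (lawT p y τ W b (t.val + 1)))
      = 4 * (Q (lawT p y τ W b 0) - Q (lawT p y τ W b n)) := by
    rw [← mul_sum, Fin.sum_univ_eq_sum_range (fun t => Q (lawT p y τ W b t) - Q (lawT p y τ W b (t + 1))) n,
      Finset.sum_range_sub']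
  rw [hfree]
  refine hmono.trans ?_
  rw [htel, Q_lawT_zero]
  have hp : (0 : ℝ) < 12 * p := by have := NeZero.pos p; positivity
  have h := sq_le_Q_lawT p y τ W b n
  have : ((2 : ℝ) ^ n) ^ 2 / (12 * p) ≤ Q (lawT p y τ W b n) := by rw [div_le_iff₀ hp]; linarith
  have e : 4 * ((2 : ℝ) ^ n) ^ 2 * (1 - 1 / (12 * p)) = 4 * ((2 : ℝ) ^ n) ^ 2 - 4 * (((2 : ℝ) ^ n) ^ 2 / (12 * p)) := by
    ring
  rw [e]; linarith

/-- **a good FREE time**: if `12p < m + 1`, `m = n − |W|`, some free `t` has `D1T(τ t)(lawTp t) ≤ 2·2ⁿ·√(12p/(m+1))`. -/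
theorem exists_D1T_le_free (hm : 12 * p < (n - W.card) + 1) :
    ∃ t : Fin n, t ∉ W ∧
      D1T p (τ t) (lawTp p y τ W b t.val) ≤ 2 * (2 : ℝ) ^ n * Real.sqrt (12 * p / ((n - W.card : ℕ) + 1)) := by
  set F := (univ : Finset (Fin n)).filter (fun t => t ∉ W) with hF
  set m := n - W.card with hmdef
  have hcard : F.card = m := card_free W
  have hm0 : 0 < m := by have := NeZero.pos p; omega
  have hne : F.Nonempty := by rw [← card_pos, hcard]; exact hm0
  set B : ℝ := 4 * ((2 : ℝ) ^ n) ^ 2 * (1 - 1 / (12 * p)) with hB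
  obtain ⟨t, ht, hD2⟩ : ∃ t ∈ F, D2T p (τ t) (lawTp p y τ W b t.val) ≤ B / m := by
    apply exists_le_of_sum_le hne
    rw [sum_const, hcard, nsmul_eq_mul]
    have e : (m : ℝ) * (B / m) = B := by field_simp
    rw [e]; exact sum_D2T_free_le p y τ W b
  refine ⟨t, (mem_filter.mp ht).2, ?_⟩
  have hp : (0 : ℝ) < p := by exact_mod_cast NeZero.pos p
  have hm' : (0 : ℝ) < m := by exact_mod_cast hm0
  have hm1 : (0 : ℝ) < (m : ℝ) + 1 := by positivity
  set M : ℝ := (2 : ℝ) ^ n with hM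
  have hMpos : 0 < M := by positivity
  have h1 : D1T p (τ t) (lawTp p y τ W b t.val) ^ 2 ≤ 12 * p * (B / m) :=
    (sq_D1T_le p _ _).trans (mul_le_mul_of_nonneg_left hD2 (by positivity))
  have h2 : 12 * p * (B / m) ≤ (2 * M) ^ 2 * (12 * p / (m + 1)) := by
    rw [hB]
    have e : 12 * (p : ℝ) * (4 * M ^ 2 * (1 - 1 / (12 * p)) / m) = (2 * M) ^ 2 * ((12 * p - 1) / m) := by
      field_simp; ring
    rw [e]
    apply mul_le_mul_of_nonneg_left _ (by positivity)
    rw [div_le_div_iff₀ hm' hm1]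
    have : (12 * p : ℝ) ≤ m + 1 := by exact_mod_cast hm.le
    nlinarith
  have h3' : D1T p (τ t) (lawTp p y τ W b t.val) ^ 2 ≤ (2 * M * Real.sqrt (12 * p / (m + 1))) ^ 2 := by
    rw [mul_pow, Real.sq_sqrt (by positivity)]; exact h1.trans h2
  calc D1T p (τ t) (lawTp p y τ W b t.val) = Real.sqrt (D1T p (τ t) (lawTp p y τ W b t.val) ^ 2) :=
        (Real.sqrt_sq (D1T_nonneg p _ _)).symm
    _ ≤ Real.sqrt ((2 * M * Real.sqrt (12 * p / (m + 1))) ^ 2) := Real.sqrt_le_sqrt h3'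
    _ = 2 * M * Real.sqrt (12 * p / (m + 1)) := Real.sqrt_sq (by positivity)

/-! ## §5 `Φ` along the scheduled process and the count -/

/-- `Φ(lawTp t) ≥ 2ⁿ/3 − 2p·D1T(s)(lawTp t)` for every alien toggle `s` (the label average over `RT(s)^{2p}, RT(s)^{4p}`). -/
theorem phi_lawTp_ge (h3 : ¬ 3 ∣ p) (s : Bool × Bool) (t : ℕ) :
    (2 : ℝ) ^ n / 3 - 2 * p * D1T p s (lawTp p y τ W b t) ≤ phi (lawTp p y τ W b t) := by
  have hthird : (2 : ℝ) ^ n / 3 ≤ phi (lam p (lawTp p y τ W b t)) := by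
    rw [← sum_lawTp p y τ W b t, ← sum_lam p]
    refine phi_ge_third _ (fun x => ?_) (fun g a b' => lam_const p h3 _ g a b')
    have h0 := lawTp_nonneg p y τ W b t
    exact div_nonneg (add_nonneg (add_nonneg (h0 _) (h0 _)) (h0 _)) (by norm_num)
  have hlip := abs_phi_sub_phi_le (lawTp p y τ W b t) (lam p (lawTp p y τ W b t))
  have hl := l1_lam_le_T p s (lawTp p y τ W b t)
  rw [abs_le] at hlip
  linarith [hlip.1]

/-- **`Φ` does not decrease along the scheduled subcube process.** -/
theorem phi_lawTp_mono {t s : ℕ} (hts : t ≤ s) (hs : s ≤ n) : phi (lawTp p y τ W b t) ≤ phi (lawTp p y τ W b s) := by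
  induction s, hts using Nat.le_induction with
  | base => exact le_rfl
  | succ s hts ih =>
    have hsn : s < n := hs
    refine (ih hsn.le).trans ?_
    have hbit : phi (lawTp p y τ W b s) ≤ phi (lawT p y τ W b (s + 1)) := by
      by_cases hW : (⟨s, hsn⟩ : Fin n) ∈ W
      · have hfun : lawT p y τ W b (s + 1) = fun x : St p =>
            (fun z : St p => lawTp p y τ W b s (bx z.1 (if b ⟨s, hsn⟩ then τ ⟨s, hsn⟩ else (false, false)), z.2.1, z.2.2))
              (x.1, x.2.1 - ((1 + (b ⟨s, hsn⟩).toNat : ℕ) : ZMod 3), x.2.2 - (((b ⟨s, hsn⟩).toNat : ℕ) : ZMod p)) := by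
          funext x
          rw [lawT_succ_frozen p y τ W b ⟨s, hsn⟩ hW x]
          simp only [togSt_symm_apply, bitEq_symm_apply]
        rw [hfun, phi_shift_eq p (fun z : St p =>
          lawTp p y τ W b s (bx z.1 (if b ⟨s, hsn⟩ then τ ⟨s, hsn⟩ else (false, false)), z.2.1, z.2.2)), phi_togSt]
      · have h := phi_bitT_le p (lawTp p y τ W b s) (τ ⟨s, hsn⟩)
        have e : (fun x : St p =>
            (lawTp p y τ W b s (x.1, x.2.1 - 1, x.2.2) + lawTp p y τ W b s (bx x.1 (τ ⟨s, hsn⟩), x.2.1 - 2, x.2.2 - 1)) / 2)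
            = lawT p y τ W b (s + 1) := by
          funext x; exact (lawT_succ_free' p y τ W b ⟨s, hsn⟩ hW x).symm
        rwa [e] at h
    have hfire : phi (lawTp p y τ W b (s + 1)) = phi (lawT p y τ W b (s + 1)) := by
      have e : lawTp p y τ W b (s + 1) = fun x : St p =>
          lawT p y τ W b (s + 1) (if tabN p y (s + 1) x.2.2 then tog x.2.1 x.1 else x.1, x.2.1, x.2.2) := by
        funext x; exact lawTp_eq p y τ W b (s + 1) x
      rw [e]; exact phi_fire (lawT p y τ W b (s + 1)) (tabN p y (s + 1))
    rw [hfire]; exact hbit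

/-- the `L_{i₀}`-count of the final state: `≥ 2ⁿ/3 − 2p·D1T(τ t)(lawTp t)` for every column `κ` and every `t ≤ n`. -/
theorem card_memT_ge (h3 : ¬ 3 ∣ p) (κ : ZMod 3) (s : Bool × Bool) {t : ℕ} (ht : t ≤ n) :
    (2 : ℝ) ^ n / 3 - 2 * p * D1T p s (lawTp p y τ W b t)
      ≤ ((univ.filter fun u : Fin n → Bool =>
          mem (κ, none) (XTp p y τ (subcubeMerge W b u) n).1 (XTp p y τ (subcubeMerge W b u) n).2.1 = true).card : ℝ) := by
  rw [card_memT_eq p y τ W b (κ, none)]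
  exact ((phi_lawTp_ge p y τ W b h3 s t).trans (phi_lawTp_mono p y τ W b ht le_rfl)).trans (phi_le_mass_sum _ _)

/-- **THE BOUND**: outside `L_{(κ,0)}` at the end for at most `(2/3 + 4p√(12p/(m+1)))·2ⁿ` merged inputs. -/
theorem card_not_memT_le (h3 : ¬ 3 ∣ p) (κ : ZMod 3) :
    ((univ.filter fun u : Fin n → Bool =>
        mem (κ, none) (XTp p y τ (subcubeMerge W b u) n).1 (XTp p y τ (subcubeMerge W b u) n).2.1 = false).card : ℝ)
      ≤ (2 / 3 + 4 * p * Real.sqrt (12 * p / ((n - W.card : ℕ) + 1))) * (2 : ℝ) ^ n := by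
  set m := n - W.card with hmdef
  set P : (Fin n → Bool) → Bool := fun u =>
    mem (κ, none) (XTp p y τ (subcubeMerge W b u) n).1 (XTp p y τ (subcubeMerge W b u) n).2.1 with hP
  have hsplit : ((univ.filter fun u : Fin n → Bool => P u = false).card : ℝ)
      + ((univ.filter fun u : Fin n → Bool => P u = true).card : ℝ) = (2 : ℝ) ^ n := by
    have h := card_filter_add_card_filter_not (s := (univ : Finset (Fin n → Bool))) (fun u : Fin n → Bool => P u = false)
    rw [card_univ, Fintype.card_fun, Fintype.card_bool, Fintype.card_fin] at h
    have e : (univ.filter fun u : Fin n → Bool => ¬ P u = false) = univ.filter fun u : Fin n → Bool => P u = true := by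
      congr 1; ext u; simp
    rw [e] at h
    exact_mod_cast h
  have hp : (0 : ℝ) < p := by exact_mod_cast NeZero.pos p
  have hsq : 0 ≤ Real.sqrt (12 * p / ((m : ℝ) + 1)) := Real.sqrt_nonneg _
  have hM : (0 : ℝ) < (2 : ℝ) ^ n := pow_pos (by norm_num) n
  by_cases hmn : 12 * p < m + 1
  · obtain ⟨t, _, hD⟩ := exists_D1T_le_free p y τ W b hmn
    have hl := card_memT_ge p y τ W b h3 κ (τ t) (t.isLt.le)
    have hpD : (p : ℝ) * D1T p (τ t) (lawTp p y τ W b t.val)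
        ≤ p * (2 * (2 : ℝ) ^ n * Real.sqrt (12 * p / ((m : ℝ) + 1))) :=
      mul_le_mul_of_nonneg_left hD hp.le
    show ((univ.filter fun u : Fin n → Bool => P u = false).card : ℝ) ≤ _
    have hl' : (2 : ℝ) ^ n / 3 - 2 * p * D1T p (τ t) (lawTp p y τ W b t.val)
        ≤ ((univ.filter fun u : Fin n → Bool => P u = true).card : ℝ) := hl
    linarith
  · have h1 : 1 ≤ Real.sqrt (12 * p / ((m : ℝ) + 1)) := by
      rw [Real.one_le_sqrt, one_le_div (by positivity)]
      exact_mod_cast not_lt.mp hmn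
    show ((univ.filter fun u : Fin n → Bool => P u = false).card : ℝ) ≤ _
    have hwin : 0 ≤ ((univ.filter fun u : Fin n → Bool => P u = true).card : ℝ) := Nat.cast_nonneg _
    have hp1 : (1 : ℝ) ≤ p := by exact_mod_cast NeZero.pos p
    have hps : (1 : ℝ) ≤ p * Real.sqrt (12 * p / ((m : ℝ) + 1)) := by
      have := mul_le_mul hp1 h1 zero_le_one hp.le
      rwa [one_mul] at this
    have hco : (2 : ℝ) ^ n ≤ (2 / 3 + 4 * p * Real.sqrt (12 * p / ((m : ℝ) + 1))) * (2 : ℝ) ^ n := by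
      have : (1 : ℝ) ≤ 2 / 3 + 4 * p * Real.sqrt (12 * p / ((m : ℝ) + 1)) := by linarith
      nlinarith
    linarith

end Budget

end CounterLaw

/-! ## §6 The theorem -/

open CounterLaw in
/-- **R13⊕ ON SUBCUBES — PROVED (`3 ∤ p`).**  For every table source `y`, every schedule `τ`, every subcube `{u_W = b_W}`
and every column `κ`: the scheduled process ends outside the LOSE member `L_{(κ,0)}` on at most
`(2/3 + 4p·√(12p/(n − |W| + 1)))·2ⁿ` merged inputs. -/
theorem schedSubcube_sharp (p : ℕ) (h3 : ¬ 3 ∣ p) (hp : 0 < p) {n : ℕ}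
    (y : Fin (n + 1) → (Fin n → Bool) → Bool) (τ : Fin n → Bool × Bool) (W : Finset (Fin n)) (b : Fin n → Bool)
    (κ : ZMod 3) :
    ((univ.filter fun u : Fin n → Bool =>
        mem (κ, none) (XTp p y τ (AffBells22.subcubeMerge W b u) n).1
          (XTp p y τ (AffBells22.subcubeMerge W b u) n).2.1 = false).card : ℝ)
      ≤ (2 / 3 + 4 * p * Real.sqrt (12 * p / ((n - W.card : ℕ) + 1))) * (2 : ℝ) ^ n := by
  haveI : NeZero p := ⟨hp.ne'⟩
  exact card_not_memT_le p y τ W b h3 κ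

end Summit.QuantumAdvantage.AdviceFreeQNC0
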